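import Literature.MathematicalPhysics.PowerSystems.DroopMicrogridLossyBoundedness
import Literature.Analysis.ODE.LyapunovMatrixCertificate
import Literature.Analysis.ODE.LyapunovSymmetryRate

/-!
# The droop microgrid with `Q–V` dynamics on a LOSSY network: the linearisation at every state and
# local exponential stability of an equilibrium MODULO THE ROTATION from a Lyapunov-matrix
# certificate of the linearisation relative to a reference inverter (Khalil Thm 4.6 / 4.7), with a
# certified RATE

Topic `Literature/MathematicalPhysics/PowerSystems`, namespace
`Literature.MathematicalPhysics.PowerSystems`, sub-namespace `DroopLossy`.  Companion of
`DroopMicrogridLossyBoundedness.lean` (the lossy model `DroopLossy`, Schiffer et al. 2014 §2–§4 /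
Shin–Zavala (1a)–(1b), (4); Prop. 4.2 as printed) and the LOSSY analogue of
`DroopMicrogridHamiltonianStability.lean` (★ #224: for the LOSSLESS port-Hamiltonian model the
Hessian of `H` certifies the spectrum).  With conductances there is no energy function (Schiffer et
al. Remark 5.2: «the presence of transfer conductances hampers the derivation of energy-Lyapunov
functions»), the stability analysis of §5 there is lossless-only, and the printed route for a lossy
operating point is the generic one: «The dynamic stability condition of (7) states that the Jacobian
∂f/∂x(x*,u*) of f(·,u*) evaluated at x* is Hurwitz» (Shin–Zavala Remark 2) — modulo the rotation
`θ ↦ θ + c𝟙`, through which every equilibrium is non-hyperbolic.  This file types that route for the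
model `DroopLossy`, in the ROBUST certificate shape of the tree's
`ClassicalSwingLossyExponentialStability.lean` (G2, lossy swing model).  0 named facts.

## What is proved (for `N : DroopLossy n`, any conductances)

* §1 the Fréchet derivatives `dP x i`, `dQ x i` of the lossy flows (1a)–(1b) at every state
  (`hasFDerivAt_P`, `hasFDerivAt_Q`), the Jacobian `jacCLM x` of the closed loop and
  **`hasFDerivAt_field`** (the field is differentiable at EVERY state); rotational invariance
  `field_add_constMode`;
* §2 flat coordinates (the tree's `DroopPH.flat/unflat/rotMode` on `Idx n = Fin n ⊕ (Fin n ⊕ Fin n)`):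
  `flatField`, the Jacobian MATRIX `jacMat x`, `hasFDerivAt_flatField`, `flatField_add_smul_rotMode`,
  the angle rows `(jacMat x · u)_{θ,i} = u_{ω̃,i}`;
* §3 **`expStable_modRotation_of_lyapunovCertificate`** — Lyapunov's indirect method modulo the
  rotation from Khalil's Theorem 4.6 certificate for the linearisation RELATIVE TO A REFERENCE
  INVERTER `i₀` (tree `Literature.Analysis.ODE.exists_expStable_modSymmetry_of_lyapunovMatrix`): an
  equilibrium `x*` of the lossy closed loop, a real symmetric `P` on the flat phase space with, on
  `{u_{θ,i₀} = 0}`, `uᵀPu > 0` (`u ≠ 0`) and `uᵀP(J(x*)u − u_{ω̃,i₀}·rot) ≤ −q₀uᵀu` (`q₀ > 0`) ⇒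
  `∃ ρ k λ > 0`: every solution on `[0, T]` with `‖x(0) − x*‖ < ρ` satisfies
  `‖x(t) − (x* + (c𝟙, 0, 0))‖ ≤ k‖x(0) − x*‖e^{−λt}` for some rotation `c`;
  **`expStable_modRotation_rate_of_lyapunovCertificate`** — with `uᵀPu ≤ p₁uᵀu` in addition, every
  `0 < α' < q₀/p₁` is such a rate (tree `exists_expStable_modSymmetry_rate_of_lyapunovMatrix`);
  **`exists_solution_expStable_modRotation_of_lyapunovCertificate`** — from every `x₀` in the
  `ρ`-ball the forward-global motion EXISTS (Prop. 4.2 lossy, `exists_unique_globalSolution`, when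
  `V* > 0` and the boundedness hypotheses hold) and obeys the estimate.

THREE COLUMNS.  CERTIFIED: for MODEL `M` = `DroopLossy` (Kron-reduced inverter network with transfer
and shunt conductances, first-order filters, constant inputs) and CLASS `C` = a `ρ`-ball around an
equilibrium `x*` carrying the certificate `(P, q₀[, p₁])`: local exponential convergence to the
rotation orbit of `x*`, with a rate.  The certificate is a HYPOTHESIS (three or four inequalities
between rational quadratic forms once `x*`, `G`, `B`, `k`, `τ` are rational or boxed) that a model
seat discharges per instance; `ρ, k` existential.  Nothing here says a converter, microgrid or grid
is stable.
-/

noncomputable section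

open Real Set Filter Topology Metric Finset
open scoped Matrix

namespace Literature.MathematicalPhysics.PowerSystems

namespace DroopLossy

open DroopPH (State θCLM ωCLM VCLM Idx flat unflat flatL unflatL rotMode)

variable {n : ℕ} (N : DroopLossy n)

/-! ## §1 The linearisation of the lossy closed loop at every state -/

omit N in
/-- `θCLM i v = v_θ,i`. [folklore] -/
@[simp] private theorem θCLM_apply' (i : Fin n) (v : State n) : θCLM i v = v.1 i := by
  simp [θCLM]

omit N in
/-- `ωCLM i v = v_ω̃,i`. [folklore] -/
@[simp] private theorem ωCLM_apply' (i : Fin n) (v : State n) : ωCLM i v = v.2.1 i := by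
  simp [ωCLM]

omit N in
/-- `VCLM i v = v_V,i`. [folklore] -/
@[simp] private theorem VCLM_apply' (i : Fin n) (v : State n) : VCLM i v = v.2.2 i := by
  simp [VCLM]

omit N in
/-- The angle coordinates are differentiable with derivative `θCLM`. [folklore] -/
private theorem hasFDerivAt_θ (x : State n) (i : Fin n) :
    HasFDerivAt (fun y : State n => y.1 i) (θCLM i) x :=
  (hasFDerivAt_apply (𝕜 := ℝ) i x.1).comp x hasFDerivAt_fst

omit N in
/-- The frequency coordinates are differentiable with derivative `ωCLM`. [folklore] -/
private theorem hasFDerivAt_ω (x : State n) (i : Fin n) :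
    HasFDerivAt (fun y : State n => y.2.1 i) (ωCLM i) x := by
  have h2 : HasFDerivAt (fun y : State n => y.2) (ContinuousLinearMap.snd ℝ _ _) x :=
    hasFDerivAt_snd
  have h21 : HasFDerivAt (fun y : State n => y.2.1)
      ((ContinuousLinearMap.fst ℝ (Fin n → ℝ) (Fin n → ℝ)).comp
        (ContinuousLinearMap.snd ℝ (Fin n → ℝ) ((Fin n → ℝ) × (Fin n → ℝ)))) x :=
    hasFDerivAt_fst.comp x h2
  exact (hasFDerivAt_apply (𝕜 := ℝ) i x.2.1).comp x h21

omit N in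
/-- The voltage coordinates are differentiable with derivative `VCLM`. [folklore] -/
private theorem hasFDerivAt_V (x : State n) (i : Fin n) :
    HasFDerivAt (fun y : State n => y.2.2 i) (VCLM i) x := by
  have h2 : HasFDerivAt (fun y : State n => y.2) (ContinuousLinearMap.snd ℝ _ _) x :=
    hasFDerivAt_snd
  have h22 : HasFDerivAt (fun y : State n => y.2.2)
      ((ContinuousLinearMap.snd ℝ (Fin n → ℝ) (Fin n → ℝ)).comp
        (ContinuousLinearMap.snd ℝ (Fin n → ℝ) ((Fin n → ℝ) × (Fin n → ℝ)))) x :=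
    hasFDerivAt_snd.comp x h2
  exact (hasFDerivAt_apply (𝕜 := ℝ) i x.2.2).comp x h22

/-- **Derivative of the lossy active-power injection (1a) at `x`**, as a functional of the direction
`v`: `Σ_j ( V_iV_j(−G_ij sin θ_ij + B_ij cos θ_ij)(v_θ,i − v_θ,j) + (v_V,iV_j + V_iv_V,j)(G_ij cos θ_ij
+ B_ij sin θ_ij) )`. [cite: ShinZavala2020, eq. (1a) (differentiated), Remark 2] -/
def dP (x : State n) (i : Fin n) : State n →L[ℝ] ℝ :=
  ∑ j, ((x.2.2 i * x.2.2 j * (-N.G i j * sin (x.1 i - x.1 j) + N.B i j * cos (x.1 i - x.1 j)))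
      • (θCLM i - θCLM j)
    + (x.2.2 j * (N.G i j * cos (x.1 i - x.1 j) + N.B i j * sin (x.1 i - x.1 j))) • VCLM i
    + (x.2.2 i * (N.G i j * cos (x.1 i - x.1 j) + N.B i j * sin (x.1 i - x.1 j))) • VCLM j)

/-- `∂P_i(v)` written out. [cite: ShinZavala2020, eq. (1a), Remark 2] -/
theorem dP_apply (x : State n) (i : Fin n) (v : State n) :
    N.dP x i v = ∑ j, (x.2.2 i * x.2.2 j * (-N.G i j * sin (x.1 i - x.1 j)
        + N.B i j * cos (x.1 i - x.1 j)) * (v.1 i - v.1 j)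
      + (v.2.2 i * x.2.2 j + x.2.2 i * v.2.2 j)
        * (N.G i j * cos (x.1 i - x.1 j) + N.B i j * sin (x.1 i - x.1 j))) := by
  simp only [dP, FunLike.coe_sum, Finset.sum_apply, _root_.add_apply,
    FunLike.coe_smul, FunLike.coe_sub, Pi.smul_apply, Pi.sub_apply,
    θCLM_apply', VCLM_apply', smul_eq_mul]
  refine Finset.sum_congr rfl fun j _ => ?_
  ring

/-- **Derivative of the lossy reactive-power injection (1b) at `x`**:
`Σ_j ( V_iV_j(G_ij cos θ_ij + B_ij sin θ_ij)(v_θ,i − v_θ,j) + (v_V,iV_j + V_iv_V,j)(G_ij sin θ_ij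
− B_ij cos θ_ij) )`. [cite: ShinZavala2020, eq. (1b) (differentiated), Remark 2] -/
def dQ (x : State n) (i : Fin n) : State n →L[ℝ] ℝ :=
  ∑ j, ((x.2.2 i * x.2.2 j * (N.G i j * cos (x.1 i - x.1 j) + N.B i j * sin (x.1 i - x.1 j)))
      • (θCLM i - θCLM j)
    + (x.2.2 j * (N.G i j * sin (x.1 i - x.1 j) - N.B i j * cos (x.1 i - x.1 j))) • VCLM i
    + (x.2.2 i * (N.G i j * sin (x.1 i - x.1 j) - N.B i j * cos (x.1 i - x.1 j))) • VCLM j)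

/-- `∂Q_i(v)` written out. [cite: ShinZavala2020, eq. (1b), Remark 2] -/
theorem dQ_apply (x : State n) (i : Fin n) (v : State n) :
    N.dQ x i v = ∑ j, (x.2.2 i * x.2.2 j * (N.G i j * cos (x.1 i - x.1 j)
        + N.B i j * sin (x.1 i - x.1 j)) * (v.1 i - v.1 j)
      + (v.2.2 i * x.2.2 j + x.2.2 i * v.2.2 j)
        * (N.G i j * sin (x.1 i - x.1 j) - N.B i j * cos (x.1 i - x.1 j))) := by
  simp only [dQ, FunLike.coe_sum, Finset.sum_apply, _root_.add_apply,
    FunLike.coe_smul, FunLike.coe_sub, Pi.smul_apply, Pi.sub_apply,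
    θCLM_apply', VCLM_apply', smul_eq_mul]
  refine Finset.sum_congr rfl fun j _ => ?_
  ring

/-- The lossy `P_i` is Fréchet differentiable at every state with derivative `dP x i`.
[cite: ShinZavala2020, eq. (1a), Remark 2] -/
theorem hasFDerivAt_P (x : State n) (i : Fin n) :
    HasFDerivAt (fun y : State n => N.P y.1 y.2.2 i) (N.dP x i) x := by
  unfold P
  refine (HasFDerivAt.fun_sum (u := Finset.univ) fun j _ =>
    ((hasFDerivAt_V x i).fun_mul (hasFDerivAt_V x j)).fun_mul
      ((((Real.hasDerivAt_cos _).comp_hasFDerivAt x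
          ((hasFDerivAt_θ x i).fun_sub (hasFDerivAt_θ x j))).const_mul (N.G i j)).fun_add
        (((Real.hasDerivAt_sin _).comp_hasFDerivAt x
          ((hasFDerivAt_θ x i).fun_sub (hasFDerivAt_θ x j))).const_mul (N.B i j)))).congr_fderiv ?_
  refine ContinuousLinearMap.ext fun v => ?_
  rw [dP_apply]
  simp only [FunLike.coe_sum, Finset.sum_apply, _root_.add_apply,
    FunLike.coe_smul, FunLike.coe_sub, Pi.smul_apply, Pi.sub_apply,
    θCLM_apply', VCLM_apply', smul_eq_mul, Function.comp_apply]
  refine Finset.sum_congr rfl fun j _ => ?_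
  ring

/-- The lossy `Q_i` is Fréchet differentiable at every state with derivative `dQ x i`.
[cite: ShinZavala2020, eq. (1b), Remark 2] -/
theorem hasFDerivAt_Q (x : State n) (i : Fin n) :
    HasFDerivAt (fun y : State n => N.Q y.1 y.2.2 i) (N.dQ x i) x := by
  unfold Q
  refine (HasFDerivAt.fun_sum (u := Finset.univ) fun j _ =>
    ((hasFDerivAt_V x i).fun_mul (hasFDerivAt_V x j)).fun_mul
      ((((Real.hasDerivAt_sin _).comp_hasFDerivAt x
          ((hasFDerivAt_θ x i).fun_sub (hasFDerivAt_θ x j))).const_mul (N.G i j)).fun_sub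
        (((Real.hasDerivAt_cos _).comp_hasFDerivAt x
          ((hasFDerivAt_θ x i).fun_sub (hasFDerivAt_θ x j))).const_mul (N.B i j)))).congr_fderiv ?_
  refine ContinuousLinearMap.ext fun v => ?_
  rw [dQ_apply]
  simp only [FunLike.coe_sum, Finset.sum_apply, _root_.add_apply,
    FunLike.coe_smul, FunLike.coe_sub, Pi.smul_apply, Pi.sub_apply,
    θCLM_apply', VCLM_apply', smul_eq_mul, Function.comp_apply]
  refine Finset.sum_congr rfl fun j _ => ?_
  ring

/-- **The Jacobian of the lossy closed loop at the state `x`** as a continuous linear map: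
`v ↦ ( v_ω̃ , ((−v_ω̃,i − k_Pi ∂P_i(v))/τ_Pi)_i , ((−v_V,i − k_Qi ∂Q_i(v))/τ_Qi)_i )`.
[cite: ShinZavala2020, Remark 2 («the Jacobian ∂f/∂x(x*,u*) of f(·,u*)») with eqs. (4a)–(4d)] -/
def jacCLM (x : State n) : State n →L[ℝ] State n :=
  (ContinuousLinearMap.pi fun i => ωCLM i).prod
    ((ContinuousLinearMap.pi fun i => (N.τP i)⁻¹ • (-ωCLM i - N.kP i • N.dP x i)).prod
      (ContinuousLinearMap.pi fun i => (N.τQ i)⁻¹ • (-VCLM i - N.kQ i • N.dQ x i)))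

/-- Rows of the lossy Jacobian. [cite: ShinZavala2020, Remark 2] -/
theorem jacCLM_apply (x v : State n) :
    N.jacCLM x v = (fun i => v.2.1 i, fun i => (-v.2.1 i - N.kP i * N.dP x i v) / N.τP i,
      fun i => (-v.2.2 i - N.kQ i * N.dQ x i v) / N.τQ i) := by
  refine Prod.ext (funext fun i => ?_) (Prod.ext (funext fun i => ?_) (funext fun i => ?_))
  · simp [jacCLM]
  · simp only [jacCLM, ContinuousLinearMap.prod_apply, ContinuousLinearMap.pi_apply,
      FunLike.coe_smul, FunLike.coe_sub, _root_.neg_apply,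
      Pi.smul_apply, Pi.sub_apply, ωCLM_apply', smul_eq_mul]
    rw [div_eq_inv_mul]
  · simp only [jacCLM, ContinuousLinearMap.prod_apply, ContinuousLinearMap.pi_apply,
      FunLike.coe_smul, FunLike.coe_sub, _root_.neg_apply,
      Pi.smul_apply, Pi.sub_apply, VCLM_apply', smul_eq_mul]
    rw [div_eq_inv_mul]

/-- **Linearisation: the lossy closed loop is Fréchet differentiable at EVERY state `x` with
derivative `jacCLM x`.** [cite: ShinZavala2020, Remark 2 with eqs. (1a)–(1b), (4a)–(4d)] -/
theorem hasFDerivAt_field (x : State n) : HasFDerivAt N.field (N.jacCLM x) x := by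
  have hfield : N.field = fun y : State n =>
      (fun i => y.2.1 i,
        fun i => (N.τP i)⁻¹ * (-y.2.1 i - N.kP i * (N.P y.1 y.2.2 i - N.Pu i)),
        fun i => (N.τQ i)⁻¹ * (-y.2.2 i - N.kQ i * (N.Q y.1 y.2.2 i - N.Qu i))) := by
    funext y
    simp only [field, div_eq_inv_mul]
  rw [hfield]
  refine (hasFDerivAt_pi.2 fun i => ?_).prodMk
    ((hasFDerivAt_pi.2 fun i => ?_).prodMk (hasFDerivAt_pi.2 fun i => ?_))
  · exact (hasFDerivAt_ω x i).congr_fderiv (ContinuousLinearMap.ext fun v => by simp)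
  · refine (((hasFDerivAt_ω x i).neg.fun_sub
      (((N.hasFDerivAt_P x i).sub_const (N.Pu i)).const_mul (N.kP i))).const_mul
        (N.τP i)⁻¹).congr_fderiv (ContinuousLinearMap.ext fun v => ?_)
    simp [sub_eq_add_neg]
  · refine (((hasFDerivAt_V x i).neg.fun_sub
      (((N.hasFDerivAt_Q x i).sub_const (N.Qu i)).const_mul (N.kQ i))).const_mul
        (N.τQ i)⁻¹).congr_fderiv (ContinuousLinearMap.ext fun v => ?_)
    simp [sub_eq_add_neg]

/-- `P_i` depends on the angles only through differences. [cite: SchifferEtAl2014, §5 («invariant to a shift»)] -/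
theorem P_add_const (θ V : Fin n → ℝ) (c : ℝ) : N.P (fun i => θ i + c) V = N.P θ V := by
  ext i; simp [P, add_sub_add_right_eq_sub]

/-- `Q_i` depends on the angles only through differences. [cite: SchifferEtAl2014, §5] -/
theorem Q_add_const (θ V : Fin n → ℝ) (c : ℝ) : N.Q (fun i => θ i + c) V = N.Q θ V := by
  ext i; simp [Q, add_sub_add_right_eq_sub]

/-- **Rotational invariance of the lossy closed loop**: `f(θ + c𝟙, ω̃, V) = f(θ, ω̃, V)`.
[cite: SchifferEtAl2014, §5 («up to a uniform shift of all angles»)] -/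
theorem field_add_constMode (x : State n) (c : ℝ) :
    N.field (x + ((fun _ => c, 0, 0) : State n)) = N.field x := by
  obtain ⟨θ, ω, V⟩ := x
  have hθ : (θ + fun _ => c) = fun i => θ i + c := rfl
  simp only [field, Prod.mk_add_mk, add_zero, hθ, N.P_add_const, N.Q_add_const]

/-! ## §2 Flat coordinates: the Jacobian matrix and the symmetry direction -/

omit N in
/-- [folklore] -/
private theorem flat_unflat' (y : Idx n → ℝ) : flat (unflat y) = y := by
  ext (i | i | i) <;> rfl

omit N in
/-- [folklore] -/
private theorem flat_add' (x x' : State n) : flat (x + x') = flat x + flat x' := by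
  ext (i | i | i) <;> rfl

omit N in
/-- [folklore] -/
private theorem flat_sub' (x x' : State n) : flat (x - x') = flat x - flat x' := by
  ext (i | i | i) <;> rfl

omit N in
/-- [folklore] -/
private theorem flat_constMode' (c : ℝ) : flat ((fun _ => c, 0, 0) : State n) = c • rotMode n := by
  ext (i | i | i) <;> simp [flat, rotMode]

omit N in
/-- [folklore] -/
private theorem unflat_add_smul_rotMode' (y : Idx n → ℝ) (c : ℝ) :
    unflat (y + c • rotMode n) = unflat y + ((fun _ => c, 0, 0) : State n) := by
  refine Prod.ext (funext fun i => ?_) (Prod.ext (funext fun i => ?_) (funext fun i => ?_)) <;>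
    simp [unflat, rotMode]

omit N in
/-- The flat coordinates preserve the sup norm. [folklore] -/
private theorem norm_flat' (x : State n) : ‖flat x‖ = ‖x‖ := by
  apply le_antisymm
  · refine (pi_norm_le_iff_of_nonneg (norm_nonneg x)).2 ?_
    rintro (i | i | i)
    · exact (norm_le_pi_norm x.1 i).trans (norm_fst_le x)
    · exact (norm_le_pi_norm x.2.1 i).trans ((norm_fst_le x.2).trans (norm_snd_le x))
    · exact (norm_le_pi_norm x.2.2 i).trans ((norm_snd_le x.2).trans (norm_snd_le x))
  · rw [Prod.norm_def, Prod.norm_def]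
    refine max_le ?_ (max_le ?_ ?_)
    · exact (pi_norm_le_iff_of_nonneg (norm_nonneg _)).2 fun i =>
        norm_le_pi_norm (flat x) (Sum.inl i)
    · exact (pi_norm_le_iff_of_nonneg (norm_nonneg _)).2 fun i =>
        norm_le_pi_norm (flat x) (Sum.inr (Sum.inl i))
    · exact (pi_norm_le_iff_of_nonneg (norm_nonneg _)).2 fun i =>
        norm_le_pi_norm (flat x) (Sum.inr (Sum.inr i))

/-- **The lossy closed loop in flat coordinates**: `flatField = flat ∘ f ∘ unflat` on
`Idx n = Fin n ⊕ (Fin n ⊕ Fin n)`. [cite: ShinZavala2020, eqs. (4a)–(4d)] -/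
def flatField (y : Idx n → ℝ) : Idx n → ℝ := flat (N.field (unflat y))

/-- [cite: ShinZavala2020, eqs. (4a)–(4d)] -/
theorem flatField_flat (x : State n) : N.flatField (flat x) = flat (N.field x) := rfl

/-- Rotational invariance in flat coordinates. [cite: SchifferEtAl2014, §5] -/
theorem flatField_add_smul_rotMode (y : Idx n → ℝ) (c : ℝ) :
    N.flatField (y + c • rotMode n) = N.flatField y := by
  simp only [flatField, unflat_add_smul_rotMode', N.field_add_constMode]

/-- **The Jacobian MATRIX of the lossy closed loop at `x` in flat coordinates** (the matrix of
`v ↦ flat (∂f/∂x(x)(unflat v))`) — the object a certificate is written against.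
[cite: ShinZavala2020, Remark 2] -/
def jacMat (x : State n) : Matrix (Idx n) (Idx n) ℝ :=
  LinearMap.toMatrix'
    ((flatL n).toLinearMap ∘ₗ (N.jacCLM x).toLinearMap ∘ₗ (unflatL n).toLinearMap)

/-- `jacMat x · y = flat (∂f/∂x(x)(unflat y))`. [cite: ShinZavala2020, Remark 2] -/
theorem jacMat_mulVec (x : State n) (y : Idx n → ℝ) :
    N.jacMat x *ᵥ y = flat (N.jacCLM x (unflat y)) := by
  rw [jacMat, ← Matrix.toLin'_apply, Matrix.toLin'_toMatrix']
  rfl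

/-- The angle rows of the Jacobian matrix: `(J(x)u)_{θ,i} = u_{ω̃,i}`. [cite: ShinZavala2020, eq. (4a)] -/
theorem jacMat_mulVec_inl (x : State n) (y : Idx n → ℝ) (i : Fin n) :
    (N.jacMat x *ᵥ y) (Sum.inl i) = y (Sum.inr (Sum.inl i)) := by
  rw [jacMat_mulVec, jacCLM_apply]
  rfl

/-- The frequency rows of the Jacobian matrix:
`(J(x)u)_{ω̃,i} = (−u_{ω̃,i} − k_Pi ∂P_i(x)(unflat u))/τ_Pi`. [cite: ShinZavala2020, eq. (4c), Remark 2] -/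
theorem jacMat_mulVec_inr_inl (x : State n) (y : Idx n → ℝ) (i : Fin n) :
    (N.jacMat x *ᵥ y) (Sum.inr (Sum.inl i))
      = (-y (Sum.inr (Sum.inl i)) - N.kP i * N.dP x i (unflat y)) / N.τP i := by
  rw [jacMat_mulVec, jacCLM_apply]
  rfl

/-- The voltage rows of the Jacobian matrix:
`(J(x)u)_{V,i} = (−u_{V,i} − k_Qi ∂Q_i(x)(unflat u))/τ_Qi`. [cite: ShinZavala2020, eq. (4d), Remark 2] -/
theorem jacMat_mulVec_inr_inr (x : State n) (y : Idx n → ℝ) (i : Fin n) :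
    (N.jacMat x *ᵥ y) (Sum.inr (Sum.inr i))
      = (-y (Sum.inr (Sum.inr i)) - N.kQ i * N.dQ x i (unflat y)) / N.τQ i := by
  rw [jacMat_mulVec, jacCLM_apply]
  rfl

/-- **Linearisation in flat coordinates**: `flatField` is Fréchet differentiable at `flat x` with
derivative the matrix `jacMat x`. [cite: ShinZavala2020, Remark 2] -/
theorem hasFDerivAt_flatField (x : State n) :
    HasFDerivAt N.flatField (LinearMap.toContinuousLinearMap (Matrix.toLin' (N.jacMat x)))
      (flat x) := by
  have h1 : HasFDerivAt (unflatL n) (unflatL n) (flat x) := (unflatL n).hasFDerivAt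
  have h2 : HasFDerivAt N.field (N.jacCLM x) (unflatL n (flat x)) := N.hasFDerivAt_field x
  have h3 : HasFDerivAt (flatL n) (flatL n) (N.field (unflatL n (flat x))) := (flatL n).hasFDerivAt
  have h := h3.comp (flat x) (h2.comp (flat x) h1)
  have hF : N.flatField = (flatL n) ∘ N.field ∘ (unflatL n) := rfl
  rw [hF]
  refine h.congr_fderiv (ContinuousLinearMap.ext fun y => ?_)
  rw [LinearMap.coe_toContinuousLinearMap', Matrix.toLin'_apply, jacMat_mulVec]
  rfl

omit N in
/-- The rank-one projected Jacobian applied: `(J − r((ℓ·r)⁻¹ℓᵀJ))h = Jh − ((ℓ·Jh)/(ℓ·r)) r`.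
[folklore] -/
private theorem projJac_mulVec_eq (J : Matrix (Idx n) (Idx n) ℝ) (l r h : Idx n → ℝ) :
    (J - Matrix.vecMulVec r ((l ⬝ᵥ r)⁻¹ • (Matrix.vecMul l J))) *ᵥ h
      = J *ᵥ h - ((l ⬝ᵥ (J *ᵥ h)) / (l ⬝ᵥ r)) • r := by
  ext i
  simp only [Matrix.sub_mulVec, Pi.sub_apply, Pi.smul_apply, smul_eq_mul]
  congr 1
  simp only [Matrix.mulVec, Matrix.vecMulVec_apply, dotProduct, Pi.smul_apply, smul_eq_mul,
    Matrix.vecMul, Finset.sum_mul, Finset.mul_sum]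
  rw [Finset.sum_comm]
  simp only [div_eq_mul_inv, Finset.sum_mul]
  exact Finset.sum_congr rfl fun j _ => Finset.sum_congr rfl fun k _ => by ring

/-! ## §3 Local exponential stability modulo the rotation from a Lyapunov-matrix certificate of the
linearisation relative to a reference inverter, with a rate -/

/-- **LOSSY droop microgrid with `Q–V` dynamics — an equilibrium with a Lyapunov-matrix certificate
of its linearisation relative to a reference inverter `i₀` is locally exponentially stable modulo the
rotation.**  `x*` an equilibrium of the lossy closed loop (`field x* = 0`; any conductances `G`);
`P` a real symmetric matrix on the flat phase space `Idx n → ℝ` (`Idx n = Fin n ⊕ (Fin n ⊕ Fin n)`: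
angles | frequencies | voltages) such that, for every `u` with `u_{θ,i₀} = 0`: `uᵀPu > 0` if
`u ≠ 0`, and `uᵀP(J(x*)u − u_{ω̃,i₀}·rot) ≤ −q₀uᵀu` (`q₀ > 0`; `J(x*) = jacMat x*`,
`rot = (𝟙, 0, 0)`).  Then there are `ρ, k, λ > 0` such that every solution `x(·)` of the closed
loop on `[0, T]` with `‖x(0) − x*‖ < ρ` satisfies, for some rotation `c`,
`‖x(t) − (x* + (c𝟙, 0, 0))‖ ≤ k‖x(0) − x*‖e^{−λt}` on `[0, T]` (sup norms).  This is «the Jacobian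
… evaluated at x* is Hurwitz» (Remark 2) made precise on the rotation quotient and certified by
Khalil's Theorem 4.6; the certificate survives an equilibrium known only inside a box.  MODEL:
`DroopLossy`; `(P, q₀)` a hypothesis; `ρ, k, λ` existential.
[cite: ShinZavala2020, Remark 2; Khalil2002, Theorem 4.6 (sufficiency) and Theorem 4.7 (part 1); SchifferEtAl2014, §5 («up to a uniform shift of all angles»), Remark 5.2] -/
theorem expStable_modRotation_of_lyapunovCertificate (i₀ : Fin n) {xs : State n}
    (heq : N.field xs = 0) {P : Matrix (Idx n) (Idx n) ℝ} (hP : P.IsSymm) {q₀ : ℝ} (hq₀ : 0 < q₀)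
    (hpos : ∀ u : Idx n → ℝ, u (Sum.inl i₀) = 0 → u ≠ 0 → 0 < u ⬝ᵥ (P *ᵥ u))
    (hlyap : ∀ u : Idx n → ℝ, u (Sum.inl i₀) = 0 →
      u ⬝ᵥ (P *ᵥ (N.jacMat xs *ᵥ u - u (Sum.inr (Sum.inl i₀)) • rotMode n)) ≤ -(q₀ * (u ⬝ᵥ u))) :
    ∃ ρ > 0, ∃ k > 0, ∃ lam > 0, ∀ (X : ℝ → State n) (T : ℝ), N.IsSolutionOn X (Icc 0 T) →
      ‖X 0 - xs‖ < ρ → ∃ c : ℝ, ∀ t ∈ Icc 0 T,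
        ‖X t - (xs + ((fun _ => c, 0, 0) : State n))‖ ≤ k * ‖X 0 - xs‖ * Real.exp (-lam * t) := by
  set x₀ : Idx n → ℝ := flat xs with hx₀
  have hf : HasFDerivAt N.flatField
      (LinearMap.toContinuousLinearMap (Matrix.toLin' (N.jacMat xs))) x₀ := N.hasFDerivAt_flatField xs
  have hf0 : N.flatField x₀ = 0 := by
    rw [hx₀, flatField_flat, heq]; ext (i | i | i) <;> rfl
  have hsym : ∀ (y : Idx n → ℝ) (c : ℝ), N.flatField (y + c • rotMode n) = N.flatField y :=
    N.flatField_add_smul_rotMode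
  set l : Idx n → ℝ := Pi.single (Sum.inl i₀) 1 with hl
  have hlu : ∀ u : Idx n → ℝ, l ⬝ᵥ u = u (Sum.inl i₀) := fun u => by
    rw [hl, single_dotProduct, one_mul]
  have hlr : l ⬝ᵥ rotMode n = 1 := by rw [hlu]; simp [rotMode]
  have hlr0 : l ⬝ᵥ rotMode n ≠ 0 := by rw [hlr]; exact one_ne_zero
  have hproj : ∀ u : Idx n → ℝ,
      (N.jacMat xs - Matrix.vecMulVec (rotMode n) ((l ⬝ᵥ rotMode n)⁻¹ •
        (Matrix.vecMul l (N.jacMat xs)))) *ᵥ u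
        = N.jacMat xs *ᵥ u - u (Sum.inr (Sum.inl i₀)) • rotMode n := by
    intro u
    rw [projJac_mulVec_eq, hlr, div_one, hlu, jacMat_mulVec_inl]
  obtain ⟨ρ, hρ, k, hk, lam, hlam, H⟩ :=
    Literature.Analysis.ODE.exists_expStable_modSymmetry_of_lyapunovMatrix hf hf0 hsym hlr0 hP hq₀
      (fun u hu hu0 => hpos u (by rw [← hlu u]; exact hu) hu0)
      (fun u hu => by rw [hproj]; exact hlyap u (by rw [← hlu u]; exact hu))
  refine ⟨ρ, hρ, k, hk, lam, hlam, fun X T hX hX0 => ?_⟩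
  have hY : ∀ s ∈ Icc (0 : ℝ) T,
      HasDerivWithinAt (fun s => flat (X s)) (N.flatField (flat (X s))) (Icc 0 T) s := by
    intro s hs
    have h := (flatL n).hasFDerivAt.comp_hasDerivWithinAt s (hX s hs)
    exact h
  have hnorm0 : ‖flat (X 0) - x₀‖ = ‖X 0 - xs‖ := by rw [hx₀, ← flat_sub', norm_flat']
  obtain ⟨c, hc⟩ := H (fun s => flat (X s)) T hY (by rw [hnorm0]; exact hX0)
  refine ⟨c, fun t ht => ?_⟩
  have h := hc t ht
  have e : flat (X t) - (x₀ + c • rotMode n)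
      = flat (X t - (xs + ((fun _ => c, 0, 0) : State n))) := by
    rw [flat_sub', flat_add', flat_constMode']
  rwa [e, norm_flat', hnorm0] at h

/-- **The RATE from the certificate.**  With `uᵀPu ≤ p₁uᵀu` on `{u_{θ,i₀} = 0}` in addition, every
`0 < α' < q₀/p₁` is an exponential rate of the NONLINEAR lossy closed loop modulo the rotation:
`∃ ρ k > 0`, `‖x(t) − (x* + (c𝟙,0,0))‖ ≤ k‖x(0) − x*‖e^{−α't}` on every `[0, T]` for solutions with
`‖x(0) − x*‖ < ρ`. [cite: Khalil2002, Theorem 4.6, Theorem 4.7 (part 1) with Corollary 4.3; ShinZavala2020, Remark 2] -/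
theorem expStable_modRotation_rate_of_lyapunovCertificate (i₀ : Fin n) {xs : State n}
    (heq : N.field xs = 0) {P : Matrix (Idx n) (Idx n) ℝ} (hP : P.IsSymm) {q₀ p₁ : ℝ}
    (hq₀ : 0 < q₀)
    (hpos : ∀ u : Idx n → ℝ, u (Sum.inl i₀) = 0 → u ≠ 0 → 0 < u ⬝ᵥ (P *ᵥ u))
    (hupp : ∀ u : Idx n → ℝ, u (Sum.inl i₀) = 0 → u ⬝ᵥ (P *ᵥ u) ≤ p₁ * (u ⬝ᵥ u))
    (hlyap : ∀ u : Idx n → ℝ, u (Sum.inl i₀) = 0 →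
      u ⬝ᵥ (P *ᵥ (N.jacMat xs *ᵥ u - u (Sum.inr (Sum.inl i₀)) • rotMode n)) ≤ -(q₀ * (u ⬝ᵥ u)))
    {α' : ℝ} (hα'0 : 0 < α') (hα' : α' < q₀ / p₁) :
    ∃ ρ > 0, ∃ k > 0, ∀ (X : ℝ → State n) (T : ℝ), N.IsSolutionOn X (Icc 0 T) →
      ‖X 0 - xs‖ < ρ → ∃ c : ℝ, ∀ t ∈ Icc 0 T,
        ‖X t - (xs + ((fun _ => c, 0, 0) : State n))‖ ≤ k * ‖X 0 - xs‖ * Real.exp (-α' * t) := by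
  set x₀ : Idx n → ℝ := flat xs with hx₀
  have hf : HasFDerivAt N.flatField
      (LinearMap.toContinuousLinearMap (Matrix.toLin' (N.jacMat xs))) x₀ := N.hasFDerivAt_flatField xs
  have hf0 : N.flatField x₀ = 0 := by
    rw [hx₀, flatField_flat, heq]; ext (i | i | i) <;> rfl
  have hsym : ∀ (y : Idx n → ℝ) (c : ℝ), N.flatField (y + c • rotMode n) = N.flatField y :=
    N.flatField_add_smul_rotMode
  set l : Idx n → ℝ := Pi.single (Sum.inl i₀) 1 with hl
  have hlu : ∀ u : Idx n → ℝ, l ⬝ᵥ u = u (Sum.inl i₀) := fun u => by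
    rw [hl, single_dotProduct, one_mul]
  have hlr : l ⬝ᵥ rotMode n = 1 := by rw [hlu]; simp [rotMode]
  have hlr0 : l ⬝ᵥ rotMode n ≠ 0 := by rw [hlr]; exact one_ne_zero
  have hproj : ∀ u : Idx n → ℝ,
      (N.jacMat xs - Matrix.vecMulVec (rotMode n) ((l ⬝ᵥ rotMode n)⁻¹ •
        (Matrix.vecMul l (N.jacMat xs)))) *ᵥ u
        = N.jacMat xs *ᵥ u - u (Sum.inr (Sum.inl i₀)) • rotMode n := by
    intro u
    rw [projJac_mulVec_eq, hlr, div_one, hlu, jacMat_mulVec_inl]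
  obtain ⟨ρ, hρ, k, hk, H⟩ :=
    Literature.Analysis.ODE.exists_expStable_modSymmetry_rate_of_lyapunovMatrix hf hf0 hsym hlr0 hP
      hq₀ (fun u hu hu0 => hpos u (by rw [← hlu u]; exact hu) hu0)
      (fun u hu => hupp u (by rw [← hlu u]; exact hu))
      (fun u hu => by rw [hproj]; exact hlyap u (by rw [← hlu u]; exact hu)) hα'0 hα'
  refine ⟨ρ, hρ, k, hk, fun X T hX hX0 => ?_⟩
  have hY : ∀ s ∈ Icc (0 : ℝ) T,
      HasDerivWithinAt (fun s => flat (X s)) (N.flatField (flat (X s))) (Icc 0 T) s := by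
    intro s hs
    exact (flatL n).hasFDerivAt.comp_hasDerivWithinAt s (hX s hs)
  have hnorm0 : ‖flat (X 0) - x₀‖ = ‖X 0 - xs‖ := by rw [hx₀, ← flat_sub', norm_flat']
  obtain ⟨c, hc⟩ := H (fun s => flat (X s)) T hY (by rw [hnorm0]; exact hX0)
  refine ⟨c, fun t ht => ?_⟩
  have h := hc t ht
  have e : flat (X t) - (x₀ + c • rotMode n)
      = flat (X t - (xs + ((fun _ => c, 0, 0) : State n))) := by
    rw [flat_sub', flat_add', flat_constMode']
  rwa [e, norm_flat', hnorm0] at h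

/-- **From initial data (existence + estimate).**  Under the certificate of
`expStable_modRotation_of_lyapunovCertificate` at an equilibrium `x*` with `V* > 0`, on a network
satisfying the boundedness hypotheses of Prop. 4.2 (`G`, `B` symmetric, `B` dominantly inductive,
`k, τ > 0`, `Q^u > 0`), there are `ρ, k, λ > 0` such that from EVERY `x₀` with `‖x₀ − x*‖ < ρ` the
forward-global motion exists, is unique, and obeys `‖x(t) − (x* + (c_T𝟙,0,0))‖ ≤ k‖x₀ − x*‖e^{−λt}`
on every `[0, T]` for some rotation `c_T`. [cite: ShinZavala2020, Remark 2; SchifferEtAl2014, Prop. 4.2; Khalil2002, Theorems 4.6–4.7] -/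
theorem exists_solution_expStable_modRotation_of_lyapunovCertificate
    (hG : ∀ i j, N.G i j = N.G j i) (hB : ∀ i j, N.B i j = N.B j i) (hkP : ∀ i, 0 < N.kP i)
    (hτP : ∀ i, 0 < N.τP i) (hkQ : ∀ i, 0 < N.kQ i) (hτQ : ∀ i, 0 < N.τQ i)
    (hBoff : ∀ i j, i ≠ j → 0 ≤ N.B i j) (hBrow : ∀ i, ∑ j, N.B i j ≤ 0) (hQu : ∀ i, 0 < N.Qu i)
    (i₀ : Fin n) {xs : State n} (heq : N.field xs = 0) (hV : ∀ i, 0 < xs.2.2 i)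
    {P : Matrix (Idx n) (Idx n) ℝ} (hP : P.IsSymm) {q₀ : ℝ} (hq₀ : 0 < q₀)
    (hpos : ∀ u : Idx n → ℝ, u (Sum.inl i₀) = 0 → u ≠ 0 → 0 < u ⬝ᵥ (P *ᵥ u))
    (hlyap : ∀ u : Idx n → ℝ, u (Sum.inl i₀) = 0 →
      u ⬝ᵥ (P *ᵥ (N.jacMat xs *ᵥ u - u (Sum.inr (Sum.inl i₀)) • rotMode n)) ≤ -(q₀ * (u ⬝ᵥ u))) :
    ∃ ρ > 0, ∃ k > 0, ∃ lam > 0, ∀ x₀ : State n, ‖x₀ - xs‖ < ρ →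
      ∃ X : ℝ → State n, X 0 = x₀ ∧ (∀ T : ℝ, N.IsSolutionOn X (Icc 0 T)) ∧
        (∀ Y : ℝ → State n, Y 0 = x₀ → (∀ T : ℝ, N.IsSolutionOn Y (Icc 0 T)) →
          ∀ t, 0 ≤ t → Y t = X t) ∧
        ∀ T : ℝ, ∃ c : ℝ, ∀ t ∈ Icc 0 T,
          ‖X t - (xs + ((fun _ => c, 0, 0) : State n))‖ ≤ k * ‖x₀ - xs‖ * Real.exp (-lam * t) := by
  obtain ⟨ρ, hρ, k, hk, lam, hlam, H⟩ :=
    N.expStable_modRotation_of_lyapunovCertificate i₀ heq hP hq₀ hpos hlyap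
  -- shrink `ρ` so that the ball has positive voltages
  rcases Nat.eq_zero_or_pos n with hn | hn
  · subst hn
    refine ⟨ρ, hρ, k, hk, lam, hlam, fun x₀ hx₀ => ⟨fun _ => x₀, rfl, fun T t _ => ?_,
      fun Y hY0 _ t _ => ?_, fun T => ⟨0, fun t ht => ?_⟩⟩⟩
    · have h0 : N.field x₀ = 0 := Subsingleton.elim _ _
      rw [h0]; exact hasDerivWithinAt_const _ _ _
    · rw [hY0.symm]; exact Subsingleton.elim _ _
    · have h0 : x₀ - (xs + ((fun _ => (0 : ℝ), 0, 0) : State 0)) = 0 := Subsingleton.elim _ _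
      rw [h0, norm_zero]; positivity
  haveI : Nonempty (Fin n) := ⟨⟨0, hn⟩⟩
  obtain ⟨vmin, hvmin_mem, hvmin⟩ := Finset.exists_min_image Finset.univ (fun i => xs.2.2 i)
    Finset.univ_nonempty
  have hvpos : 0 < xs.2.2 vmin := hV vmin
  set ρ' : ℝ := min ρ (xs.2.2 vmin) with hρ'
  have hρ'pos : 0 < ρ' := lt_min hρ hvpos
  refine ⟨ρ', hρ'pos, k, hk, lam, hlam, fun x₀ hx₀ => ?_⟩
  have hx₀ρ : ‖x₀ - xs‖ < ρ := lt_of_lt_of_le hx₀ (min_le_left _ _)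
  have hx₀V : ∀ i, 0 < x₀.2.2 i := by
    intro i
    have h1 : |x₀.2.2 i - xs.2.2 i| < xs.2.2 vmin := by
      have h2 : ‖(x₀ - xs).2.2 i‖ ≤ ‖x₀ - xs‖ :=
        (norm_le_pi_norm _ i).trans ((norm_snd_le _).trans (norm_snd_le _))
      have h3 : ‖x₀ - xs‖ < xs.2.2 vmin := lt_of_lt_of_le hx₀ (min_le_right _ _)
      have h4 : ‖(x₀ - xs).2.2 i‖ = |x₀.2.2 i - xs.2.2 i| := by
        rw [Real.norm_eq_abs]; rfl
      linarith [h4.symm.le]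
    have h5 := hvmin i (Finset.mem_univ i)
    have h6 := (abs_lt.1 h1).1
    linarith
  obtain ⟨X, hX0, hX, huniq, -⟩ :=
    N.exists_unique_globalSolution hG hB hkP hτP hkQ hτQ hBoff hBrow hQu x₀ hx₀V
  refine ⟨X, hX0, hX, huniq, fun T => ?_⟩
  obtain ⟨c, hc⟩ := H X T (hX T) (by rw [hX0]; exact hx₀ρ)
  exact ⟨c, fun t ht => by rw [← hX0]; exact hc t ht⟩

/-! ## §4 The exact form of the certificate: a characteristic-polynomial factorisation
`charpoly J(x*) = X·q` with `q` Hurwitz and `ker J(x*) = ℝ·rot` (for instances with exact data) -/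

/-- **LOSSY droop microgrid — the charpoly-factor certificate** (the exact-data alternative to the
Lyapunov-matrix certificate of §3, as in the tree's lossy swing file): if at an equilibrium `x*` of
the lossy closed loop the Jacobian matrix satisfies `charpoly J(x*) = X·q` with every complex root
of `q` in `Re < 0`, and `ker J(x*)` is the rotation line `ℝ(𝟙, 0, 0)`, then `x*` is locally
exponentially stable modulo the rotation (same conclusion as
`expStable_modRotation_of_lyapunovCertificate`; any reference inverter `i₀` witnesses `n ≥ 1`).
[cite: ShinZavala2020, Remark 2 («the Jacobian … is Hurwitz»); Khalil2002, Theorem 4.7 (part 1) on the rotation quotient] -/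
theorem expStable_modRotation_of_charpolyCertificate (i₀ : Fin n) {xs : State n}
    (heq : N.field xs = 0) {q : Polynomial ℝ}
    (hJq : (N.jacMat xs).charpoly = Polynomial.X * q)
    (hq : ∀ μ : ℂ, (q.map (algebraMap ℝ ℂ)).IsRoot μ → μ.re < 0)
    (hker : ∀ u : Idx n → ℝ, N.jacMat xs *ᵥ u = 0 → ∃ a : ℝ, u = a • rotMode n) :
    ∃ ρ > 0, ∃ k > 0, ∃ lam > 0, ∀ (X : ℝ → State n) (T : ℝ), N.IsSolutionOn X (Icc 0 T) →
      ‖X 0 - xs‖ < ρ → ∃ c : ℝ, ∀ t ∈ Icc 0 T,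
        ‖X t - (xs + ((fun _ => c, 0, 0) : State n))‖ ≤ k * ‖X 0 - xs‖ * Real.exp (-lam * t) := by
  set x₀ : Idx n → ℝ := flat xs with hx₀
  have hf : HasFDerivAt N.flatField
      (LinearMap.toContinuousLinearMap (Matrix.toLin' (N.jacMat xs))) x₀ := N.hasFDerivAt_flatField xs
  have hf0 : N.flatField x₀ = 0 := by
    rw [hx₀, flatField_flat, heq]; ext (i | i | i) <;> rfl
  have hsym : ∀ (y : Idx n → ℝ) (c : ℝ), N.flatField (y + c • rotMode n) = N.flatField y :=
    N.flatField_add_smul_rotMode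
  set l : Idx n → ℝ := Pi.single (Sum.inl i₀) 1 with hl
  have hlu : ∀ u : Idx n → ℝ, l ⬝ᵥ u = u (Sum.inl i₀) := fun u => by
    rw [hl, single_dotProduct, one_mul]
  have hlr0 : l ⬝ᵥ rotMode n ≠ 0 := by rw [hlu]; simp [rotMode]
  obtain ⟨ρ, hρ, k, hk, lam, hlam, H⟩ :=
    Literature.Analysis.ODE.exists_expStable_modSymmetry_of_charpoly_eq_X_mul hf hf0 hsym hlr0 hJq
      hq hker
  refine ⟨ρ, hρ, k, hk, lam, hlam, fun X T hX hX0 => ?_⟩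
  have hY : ∀ s ∈ Icc (0 : ℝ) T,
      HasDerivWithinAt (fun s => flat (X s)) (N.flatField (flat (X s))) (Icc 0 T) s := by
    intro s hs
    exact (flatL n).hasFDerivAt.comp_hasDerivWithinAt s (hX s hs)
  have hnorm0 : ‖flat (X 0) - x₀‖ = ‖X 0 - xs‖ := by rw [hx₀, ← flat_sub', norm_flat']
  obtain ⟨c, hc⟩ := H (fun s => flat (X s)) T hY (by rw [hnorm0]; exact hX0)
  refine ⟨c, fun t ht => ?_⟩
  have h := hc t ht
  have e : flat (X t) - (x₀ + c • rotMode n)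
      = flat (X t - (xs + ((fun _ => c, 0, 0) : State n))) := by
    rw [flat_sub', flat_add', flat_constMode']
  rwa [e, norm_flat', hnorm0] at h

end DroopLossy

end Literature.MathematicalPhysics.PowerSystems
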